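import Summits.ResolutionOfSingularities.ResolutionOfSingularities.Theorems.HilbertSamuelEliminationSigmaMaxModificationsCorridor3WLadderStrataKernelsIff
import Summits.ResolutionOfSingularities.ResolutionOfSingularities.Theorems.HilbertSamuelEliminationSigmaMaxModificationsCorridor3NearStep
import HarnessLib

/-!
# [OURS · L1 W4.2] The STRATA-half of the MOVING W-ladder, fifth layer: the cycle-end births row (b-end) SPLIT into the two
# printed shapes of CJS Thm. 3.14 — the NEAR FIBRE over the chain point is a point (locus form), the CENTRE through the chain
# point is a curve (numerical form) — bookkeeping PROVED

Crux chain w42 (`SigmaMaxModifications`, stmt-ResolutionOfSingularities-18506; skeleton `w_ladder` v5b on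
`SigmaMaxModificationsCorridor3`, stmt-ResolutionOfSingularities-19249), row «stub-4 → `Moving.Wlow3CharStrataM p`», seat
res-L1-w42-stub-4 (gen 3); companion of p500484 / p503069 / p503885 / p504439 / p505314 / p506465 / p508074 / p508693.
OURS (cell res-hironaka, slot W4.2); NOT statements of H. Hironaka's manuscript [Hironaka2017] nor of [CossartJannsenSaito2020];
AI-drafted, weaker than expert review. Every `theorem` is PROVED; the open content is the two `def … : Prop` rows (b-fib) and
(b-curve). Helper file `--supports stmt-ResolutionOfSingularities-19249`.

## The argument (no geometry)

Row (b-end) `StrataCycleEndBirthsSettle` (p505314): at late BLOWN-UP CYCLE-END steps no irreducible component of `X_{n+1}(ν)` through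
`x_{n+1}` is newborn. Suppose `Z' ∋ x_{n+1}` were newborn. Births lie over the centre (p505314): `Z' ⊆ π⁻¹(V(C_n))`. Let `ζ` be the
generic point of `Z'` and `a = π(ζ) ∈ V(C_n)`. EITHER `a = x_n`: then `Z' = closure {ζ}` lies in the fibre `π⁻¹(x_n)` (`x_n` is
closed) and inside `X_{n+1}(ν)` — in the NEAR FIBRE over `x_n`, which row (b-fib) `StrataNearFibreSubsingleton` declares a
subsingleton (Thm. 3.14, locus form: near points over `x ∈ D` lie in `ℙ(Dir_x(X)/T_x(D))`, a point when `e_x − dim_x D = 1`), so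
`Z' = {x_{n+1}}` — impossible at a never-isolated stage (`CycleInv.singleton_notMem_componentsIn_of_not_iso`, p504439). OR
`a ≠ x_n`: then `A = closure {a} = closure π(Z')` is an irreducible closed subset of `V(C_n)` through `x_n` other than `{x_n}`, and
row (b-curve) `StrataCentreCurveAt` (Thm. 3.14, numerical form p499700 `CossartJannsenSaito2020_thm_3_14`: `dim 𝒪_{D,x_n} <
e_{x_n} ≤ 2`, so `V(C_n)` is a regular CURVE at `x_n`) makes `A` an irreducible component of `V(C_n) = Y_n^{(j)}`
(`support_eq_part_of_next_none`, p503069), hence of `X_n(ν)` (`componentsIn_part_subset`: the components of a label part are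
components of the stratum) — so `Z'` dominates `A`: not newborn. Hence `strataCycleEndBirthsSettle_of_fibre_of_curve :
(b-fib) → (b-curve) → (b-end)`, PROVED for every `Q`, `G`; and the strata-half reads
`Wlow3CharStrataM p ⟸ (b-fib) ∧ (b-curve) ∧ (c-geo) ∧ (c-reg)` (`wlow3CharStrataM_of_fibre_curve_centreIO_cycleStartRegular`).

References: CJS LNM 2270 Thm. 3.14, Def. 3.13, Rem. 6.29 (1) [CossartJannsenSaito2020]; tree p499700 (`NearPointDirectrix`),
`Literature…AlterationsNormalFormBlowupParts` (`componentsIn_sUnion_eq`), this seat's files above.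
-/

noncomputable section

-- plan-1/idea-2 module setting kept (namespace `…Corridor3.Moving` re-enters `…Corridor3`)
set_option linter.dupNamespace false

open CategoryTheory AlgebraicGeometry TopologicalSpace Topology
open Summit.ResolutionOfSingularities.ResolutionOfSingularities.Theorems.CampaignW42
open Literature.AlgebraicGeometry.Resolution Literature.RingTheory.HilbertSamuel
open Literature.AlgebraicGeometry.CossartJannsenSaito2020
open Summit.ResolutionOfSingularities.ResolutionOfSingularities.Theorems.SigmaMaxModificationsCorridor3

universe u

namespace Summit.ResolutionOfSingularities.ResolutionOfSingularities.Theorems.SigmaMaxModificationsCorridor3.Moving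

variable {R : ∀ S : Scheme.{u}, CentreSeq S → Prop} {N : ℕ} {ν : ℕ → ℕ}

/-! ## §1. Topological lemmas: components of a label part; images of point closures -/

/-- **The irreducible components of a label part `Y^{(j)}` are irreducible components of the stratum** (the part is a finite union
of pairwise incomparable irreducible closed components). [cite: CossartJannsenSaito2020, Rem. 6.29 (1), (6.5)] -/
theorem componentsIn_part_subset {W : Scheme.{u}} (L : Labelling W) {Y : Set W} (hY : IsClosed Y)
    (hfin : (componentsIn Y).Finite) (j : ℕ) : componentsIn (L.part Y j) ⊆ componentsIn Y := by
  have heq : componentsIn (L.part Y j) = {Z | Z ∈ componentsIn Y ∧ L.label Z = j} := by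
    refine componentsIn_sUnion_eq (hfin.subset fun _ hZ => hZ.1) (fun Z hZ => componentsIn.isIrreducible hZ.1)
      (fun Z hZ => componentsIn.isClosed hY hZ.1) fun Z hZ Z' hZ' hsub => ?_
    exact Set.Subset.antisymm hsub
      ((mem_componentsIn_iff.mp hZ.1).2.2 Z' (componentsIn.subset hZ'.1) (componentsIn.isIrreducible hZ'.1) hsub)
  rw [heq]
  exact fun _ hZ => hZ.1

/-- The closure of the image of the closure of a point is the closure of the image of the point. [folklore] -/
theorem closure_image_closure_singleton {A B : Type*} [TopologicalSpace A] [TopologicalSpace B] {f : A → B}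
    (hf : Continuous f) (a : A) : closure (f '' closure {a}) = closure {f a} := by
  refine Set.Subset.antisymm ?_ (closure_mono ?_)
  · refine closure_minimal ?_ isClosed_closure
    refine (image_closure_subset_closure_image hf).trans ?_
    rw [Set.image_singleton]
  · rw [← Set.image_singleton]
    exact Set.image_mono subset_closure

/-! ## §2. The two Thm. 3.14 rows and the PROVED split of (b-end) -/

/-- [OURS · L1 W4.2] **ROW (b-fib) — THE NEAR FIBRE OVER A LATE BLOWN-UP CYCLE-END CHAIN POINT IS A POINT.** For every functional
admissible oracle, value `ν`, `Q`-maximal origin of characteristic `p` at level `N` and every MOVING, NEVER-ISOLATED `G`-chain from it: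
from some stage on, at a blown-up cycle-end step `X_{n+1} → X_n` (read through its step projection `f`), the points of `X_{n+1}(ν)`
over `x_n` form a SUBSINGLETON (they are all `x_{n+1}`). Intended proof (`G = (ē ≤ 2)`): the centre is the treated part, regular,
through `x_n`, of dimension `1` at `x_n` (row (b-curve)); CJS Thm. 3.14 in LOCUS form: the near points over `x_n` lie on
`ℙ(Dir_{x_n}(X_n)/T_{x_n}(D)) ≅ ℙ^{e−2}`, a point since `e_{x_n} ≤ ē_{x_n} ≤ 2` (res-type-053's T5b; (F1) via `QCharRegime`/`QNe`).
OURS row, OPEN; NOT a statement of the manuscript. [cite: CossartJannsenSaito2020, Thm. 3.14, Def. 3.13] -/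
def StrataNearFibreSubsingleton (p N : ℕ) (Q : ℕ → (ℕ → ℕ) → ∀ X : Scheme.{u}, X → Prop) (G : MarkedStage.{u} → Prop) : Prop :=
  ∀ (R : ∀ S : Scheme.{u}, CentreSeq S → Prop), OracleFunctional R → OracleAdmissible R →
  ∀ (ν : ℕ → ℕ) (X : Scheme.{u}) [IsLocallyNoetherian X] (x : X), IsMaximalOrigin p N ν X x → Q N ν X x →
  ∀ c : ℕ → MarkedStage.{u}, Reaches R N ν (MarkedStage.init X x) (c 0) →
    (∀ n, CanonicalNearStep R N ν (c n) (c (n + 1))) → (∀ n, G (c n)) → (∀ n, ¬ Iso N (c n)) →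
    (∀ n, ∃ m, n ≤ m ∧ (c m).IsBlownUp R N ν) →
    ∃ n₁, ∀ n, n₁ ≤ n → (c n).IsBlownUp R N ν → (c (n + 1)).P = none →
      ∀ f : (c (n + 1)).W ⟶ (c n).W, StepProjection R N ν (c n) (c (n + 1)) f →
        {z : (c (n + 1)).W | f.base z = (c n).pt ∧ z ∈ Scheme.hsStratum (c (n + 1)).W N ν}.Subsingleton

/-- [OURS · L1 W4.2] **ROW (b-curve) — AT A LATE BLOWN-UP CYCLE-END CHAIN POINT THE CENTRE IS A CURVE THROUGH IT**, in topological
form: every irreducible closed subset of the centre's support containing `x_n` is `{x_n}` or an irreducible component of the support.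
Intended proof (`G = (ē ≤ 2)`): the centre `D = (Y_n^{(j)})_red` is regular (permissible) and `x_{n+1}` is near `x_n ∈ D`, so CJS
Thm. 3.14 (numerical form, tree `CossartJannsenSaito2020_thm_3_14`, p499700) gives `dim 𝒪_{D,x_n} < e_{x_n} ≤ ē_{x_n} ≤ 2`: the
component of `D` through `x_n` has dimension `≤ 1` (it is not `{x_n}`: the chain point is never isolated), so no irreducible closed
set lies strictly between `{x_n}` and it. OURS row, OPEN; NOT a statement of the manuscript.
[cite: CossartJannsenSaito2020, Thm. 3.14, Def. 3.1] -/
def StrataCentreCurveAt (p N : ℕ) (Q : ℕ → (ℕ → ℕ) → ∀ X : Scheme.{u}, X → Prop) (G : MarkedStage.{u} → Prop) : Prop :=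
  ∀ (R : ∀ S : Scheme.{u}, CentreSeq S → Prop), OracleFunctional R → OracleAdmissible R →
  ∀ (ν : ℕ → ℕ) (X : Scheme.{u}) [IsLocallyNoetherian X] (x : X), IsMaximalOrigin p N ν X x → Q N ν X x →
  ∀ c : ℕ → MarkedStage.{u}, Reaches R N ν (MarkedStage.init X x) (c 0) →
    (∀ n, CanonicalNearStep R N ν (c n) (c (n + 1))) → (∀ n, G (c n)) → (∀ n, ¬ Iso N (c n)) →
    (∀ n, ∃ m, n ≤ m ∧ (c m).IsBlownUp R N ν) →
    ∃ n₁, ∀ n, n₁ ≤ n → (c n).IsBlownUp R N ν → (c (n + 1)).P = none →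
      ∀ (C : (c n).W.IdealSheafData) (P' : Option (Pending (blowup C))), IsCanonicalStep R N ν (c n).L (c n).P C P' →
        ∀ A : Set (c n).W, A ⊆ (C.support : Set (c n).W) → IsIrreducible A → IsClosed A → (c n).pt ∈ A →
          A = {(c n).pt} ∨ A ∈ componentsIn (C.support : Set (c n).W)

/-- **ROW (b-end) FROM (b-fib) AND (b-curve) — PROVED** (any origin predicate `Q`, any grade `G`; the generic-point case split of
the module docstring). [cite: CossartJannsenSaito2020, Thm. 3.14, Rem. 6.29 (1)] -/
theorem strataCycleEndBirthsSettle_of_fibre_of_curve {p N : ℕ} {Q : ℕ → (ℕ → ℕ) → ∀ X : Scheme.{u}, X → Prop}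
    {G : MarkedStage.{u} → Prop} (hfib : StrataNearFibreSubsingleton p N Q G) (hcurve : StrataCentreCurveAt p N Q G) :
    StrataCycleEndBirthsSettle p N Q G := by
  intro R hRf hRa ν X _ x hX hQ c h0 hstep hG hnI hmov
  obtain ⟨n₁, hn₁⟩ := hfib R hRf hRa ν X x hX hQ c h0 hstep hG hnI hmov
  obtain ⟨n₂, hn₂⟩ := hcurve R hRf hRa ν X x hX hQ c h0 hstep hG hnI hmov
  obtain ⟨hν, k, _, hinv⟩ := exists_cycleInv_chain' hRf hRa hX h0 hstep
  have hpt : ∀ n, (c n).pt ∈ Scheme.hsStratum (c n).W N ν := fun n =>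
    pt_mem_hsStratum_of_reaches hX.mem_stratum (reaches_chain h0 hstep n)
  have hptcl : ∀ n, IsClosed ({(c n).pt} : Set (c n).W) := fun n =>
    Reaches.isClosed_pt hX.isClosed (reaches_chain h0 hstep n)
  refine ⟨max n₁ n₂, fun n hn hbu hnone f hf Z' hZ' => ?_⟩
  by_contra hnot
  haveI : IsNoetherian (c n).W := (hinv n).isNoetherian
  -- births lie over the centre
  obtain ⟨C, P', hcs, hZ'sub⟩ := hf.subset_preimage_support_of_not_mem hRa hν (hinv n) hZ'.1 hnot
  -- the generic point of `Z'` and its image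
  have hY'cl : IsClosed (Scheme.hsStratum (c (n + 1)).W N ν) := (hinv (n + 1)).isClosed_hsStratum
  have hZ'irr : IsIrreducible Z' := componentsIn.isIrreducible hZ'.1
  have hZ'cl : IsClosed Z' := componentsIn.isClosed hY'cl hZ'.1
  have hζ : IsGenericPoint hZ'irr.genericPoint Z' := hZ'irr.isGenericPoint_genericPoint hZ'cl
  set ζ := hZ'irr.genericPoint with hζdef
  have hζZ : ζ ∈ Z' := hζ.mem
  have hclA : closure (f.base '' Z') = closure {f.base ζ} := by
    conv_lhs => rw [← hζ.def]
    exact closure_image_closure_singleton f.continuous ζ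
  by_cases ha : f.base ζ = (c n).pt
  · -- `Z'` lies in the near fibre over `x_n`, a subsingleton: `Z' = {x_{n+1}}`, impossible at a never-isolated stage
    have hZ'fib : Z' ⊆ {z : (c (n + 1)).W | f.base z = (c n).pt ∧ z ∈ Scheme.hsStratum (c (n + 1)).W N ν} := by
      intro z hz
      refine ⟨?_, componentsIn.subset hZ'.1 hz⟩
      have h1 : f.base z ∈ closure {f.base ζ} := by
        rw [← hclA]
        exact subset_closure ⟨z, hz, rfl⟩
      rw [ha, (hptcl n).closure_eq] at h1
      exact h1
    have hsub : Z' ⊆ {(c (n + 1)).pt} := fun z hz =>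
      (hn₁ n (le_of_max_le_left hn) hbu hnone f hf) (hZ'fib hz) (hZ'fib hZ'.2)
    have hZ'eq : Z' = {(c (n + 1)).pt} := Set.Subset.antisymm hsub (Set.singleton_subset_iff.mpr hZ'.2)
    exact (hinv (n + 1)).singleton_notMem_componentsIn_of_not_iso (hpt (n + 1)) (hnI (n + 1)) (hZ'eq ▸ hZ'.1)
  · -- `A = closure {π ζ}` is an irreducible closed subset of `V(C)` through `x_n`, not `{x_n}`: a component of `V(C) = Y^{(j)}`,
    -- hence of `X_n(ν)` — so `Z'` dominates it
    have hAsub : closure {f.base ζ} ⊆ (C.support : Set (c n).W) :=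
      closure_minimal (Set.singleton_subset_iff.mpr (hZ'sub hζZ)) C.support.isClosed
    have hAirr : IsIrreducible (closure {f.base ζ}) := isIrreducible_singleton.closure
    have hxA : (c n).pt ∈ closure {f.base ζ} := by
      rw [← hclA]
      exact subset_closure ⟨_, hZ'.2, hf.base_pt⟩
    rcases hn₂ n (le_of_max_le_right hn) hbu hnone C P' hcs _ hAsub hAirr isClosed_closure hxA with hA | hA
    · exact ha (by
        have : f.base ζ ∈ ({(c n).pt} : Set (c n).W) := hA ▸ subset_closure (Set.mem_singleton _)
        exact this)
    · apply hnot
      rw [hclA]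
      have hsupp : (C.support : Set (c n).W) = (c n).L.part (Scheme.hsStratum (c n).W N ν) (treatedLabel N ν (c n)) :=
        support_eq_part_of_next_none hRf (hstep n) hnone hcs
      rw [hsupp] at hA
      exact componentsIn_part_subset (c n).L (hinv n).isClosed_hsStratum (componentsIn.finite _) _ hA

/-- **THE STRATA-HALF FROM (b-fib), (b-curve), (c-geo), (c-reg)** (any `Q`, `G`). [cite: CossartJannsenSaito2020, Thm. 3.14, Thm. 6.35, Rem. 6.29 (1)] -/
theorem maxOriginNoMovingNearChainAtQ_notIso_of_fibre_curve_centreIO_cycleStartRegular {p N : ℕ}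
    {Q : ℕ → (ℕ → ℕ) → ∀ X : Scheme.{u}, X → Prop} {G : MarkedStage.{u} → Prop}
    (hfib : StrataNearFibreSubsingleton p N (QNe Q) G) (hcurve : StrataCentreCurveAt p N (QNe Q) G)
    (hgeo : StrataLineageInCentreIO p N (QNe Q) G) (hreg : StrataCycleStartRegular p N (QNe Q) G) :
    MaxOriginNoMovingNearChainAtQ p N Q fun s => G s ∧ ¬ Iso N s :=
  maxOriginNoMovingNearChainAtQ_notIso_of_births_centreIO_cycleStartRegular
    (strataCycleEndBirthsSettle_of_fibre_of_curve hfib hcurve) hgeo hreg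

/-- **`Wlow3CharStrataM p` (G1′) FROM (b-fib), (b-curve), (c-geo), (c-reg)** (by name; `N = 3`, `Q = QNe (QCharRegime p)`,
`G = (ē ≤ 2)`). [cite: CossartJannsenSaito2020, Thm. 3.14, Thm. 6.35, Rem. 6.29 (1)] -/
theorem wlow3CharStrataM_of_fibre_curve_centreIO_cycleStartRegular {p : ℕ}
    (hfib : StrataNearFibreSubsingleton.{0} p 3 (QNe (Helpers.QCharRegime p)) fun s => s.geomDirDim ≤ 2)
    (hcurve : StrataCentreCurveAt.{0} p 3 (QNe (Helpers.QCharRegime p)) fun s => s.geomDirDim ≤ 2)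
    (hgeo : StrataLineageInCentreIO.{0} p 3 (QNe (Helpers.QCharRegime p)) fun s => s.geomDirDim ≤ 2)
    (hreg : StrataCycleStartRegular.{0} p 3 (QNe (Helpers.QCharRegime p)) fun s => s.geomDirDim ≤ 2) :
    Wlow3CharStrataM p :=
  maxOriginNoMovingNearChainAtQ_notIso_of_fibre_curve_centreIO_cycleStartRegular hfib hcurve hgeo hreg

/-- **`WlowStrataM p` (G1′, regime-free) FROM (b-fib), (b-curve), (c-geo), (c-reg)** (`Q = ⊤`).
[cite: CossartJannsenSaito2020, Thm. 3.14, Thm. 6.35, Rem. 6.29 (1)] -/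
theorem wlowStrataM_of_fibre_curve_centreIO_cycleStartRegular {p : ℕ}
    (hfib : StrataNearFibreSubsingleton.{0} p 3 (QNe fun _ _ _ _ => True) fun s => s.geomDirDim ≤ 2)
    (hcurve : StrataCentreCurveAt.{0} p 3 (QNe fun _ _ _ _ => True) fun s => s.geomDirDim ≤ 2)
    (hgeo : StrataLineageInCentreIO.{0} p 3 (QNe fun _ _ _ _ => True) fun s => s.geomDirDim ≤ 2)
    (hreg : StrataCycleStartRegular.{0} p 3 (QNe fun _ _ _ _ => True) fun s => s.geomDirDim ≤ 2) : WlowStrataM p :=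
  maxOriginNoMovingNearChainAt_of_atQ_true
    (maxOriginNoMovingNearChainAtQ_notIso_of_fibre_curve_centreIO_cycleStartRegular hfib hcurve hgeo hreg)

/-- The strata row implies (b-fib) and (b-curve) (vacuously), so the finer decomposition is again EXACT. [folklore] -/
theorem maxOriginNoMovingNearChainAtQ_notIso_iff_fibre_curve_centreIO_cycleStartRegular {p N : ℕ}
    {Q : ℕ → (ℕ → ℕ) → ∀ X : Scheme.{u}, X → Prop} {G : MarkedStage.{u} → Prop} :
    (MaxOriginNoMovingNearChainAtQ p N Q fun s => G s ∧ ¬ Iso N s) ↔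
      StrataNearFibreSubsingleton p N (QNe Q) G ∧ StrataCentreCurveAt p N (QNe Q) G ∧
        StrataLineageInCentreIO p N (QNe Q) G ∧ StrataCycleStartRegular p N (QNe Q) G := by
  refine ⟨fun h => ?_, fun ⟨hfib, hcurve, hgeo, hreg⟩ =>
    maxOriginNoMovingNearChainAtQ_notIso_of_fibre_curve_centreIO_cycleStartRegular hfib hcurve hgeo hreg⟩
  have h' := maxOriginNoMovingNearChainAtQ_qNe_of_q h
  refine ⟨fun R hRf hRa ν X _ x hX hQ c h0 hstep hG hnI hmov =>
      (h' R hRf hRa ν X x hX hQ ⟨c, h0, hstep, fun n => ⟨hG n, hnI n⟩, hmov⟩).elim,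
    fun R hRf hRa ν X _ x hX hQ c h0 hstep hG hnI hmov =>
      (h' R hRf hRa ν X x hX hQ ⟨c, h0, hstep, fun n => ⟨hG n, hnI n⟩, hmov⟩).elim,
    strataLineageInCentreIO_of_row h', strataCycleStartRegular_of_row h'⟩

end Summit.ResolutionOfSingularities.ResolutionOfSingularities.Theorems.SigmaMaxModificationsCorridor3.Moving

end
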